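import Literature.RepresentationTheory.GeneralLinear.Sl2PlacesRationalHull
import HarnessLib

/-!
# Subalgebras of `𝔰𝔩₂ × ⋯ × 𝔰𝔩₂` surjecting on a factor: the factor is reached modulo the factors CONJUGATE to it (Goursat's lemma with classes; Hazama 1983 Prop. (2.6), Lemma (3.1) and §3 «the i-th component acts on `V_i ⊕ ⋯ ⊕ V_i` diagonally»)

Topic `Literature/RepresentationTheory/GeneralLinear`; continuation of `Sl2ProductRationalSubalgebras`
(brick R1a `single_sl2_mem_of_surjective_of_forall_exists_ne_conj`: a bracket-closed `L ⊆ ⊕_k 𝔰𝔩₂(F)`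
surjecting on the factor `i` and in graph position over NO pair `(k, i)` contains `0 ⊕ ⋯ ⊕ 𝔰𝔩₂(F) ⊕ ⋯ ⊕ 0`
at `i`) and of `Sl2PlacesRationalHull` (the places form, hypotheses (i), (a), (b)). Research context: cell
`pub-hodge-ring2` (HONEST FRAMING: research route conditional on HC_CM; not a corollary; Q11.4-sentence-2
already refuted in dim ≥ 3), Literature lane, programme R6 (V. K. Murty 1988 Thm. 2, case `m = 1`: abelian
varieties whose `End⁰` contains a totally real self-commutant subfield `K` of degree `dim A`, e.g. the type II
minimal case `End⁰(A)` a totally indefinite quaternion algebra). There the `K`-eigenblocks `V_τ` of `H¹(A) ⊗ ℂ`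
are NO LONGER pairwise non-isomorphic modules for the Hodge Lie algebra `𝔥`: Hazama 1983 §3 (p. 306), for
`A = A₁^{n} × ⋯`: «`𝔥 = 𝔰𝔩₂ × ⋯ × 𝔰𝔩₂` (k-times) where the i-th component `𝔰𝔩₂` acts on `V_i ⊕ ⋯ ⊕ V_i`
diagonally» — the blocks come in CLASSES of mutually isomorphic (conjugate) blocks, and hypothesis (b) of the
places form («no two slots conjugate») fails. This file removes hypothesis (b): WITHOUT it, the span still
contains, for every slot `i` and every trace-free `Z`, an element whose `i`-block is `Z` and whose blocks at
the slots NOT conjugate to `i` vanish (its blocks at the slots conjugate to `i` are then the conjugates of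
`Z`, forced). Pure linear algebra over fields; no Hodge theory.

MAIN RESULTS (all proved; one definition with body, no named fact — D-0026):
* `IsBlockConj S i k` (**definition**): the `i`-blocks of the members of `S ⊆ ⊕_k 𝔤𝔩₂(F)` are obtained from
  their `k`-blocks by ONE conjugation, `z i = g (z k) g⁻¹` for all `z ∈ S` (Hazama's Lemma (3.1): the graph of
  an automorphism of `𝔰𝔩₂`); an equivalence relation on the slots (`isBlockConj_refl/symm/trans`), insensitive
  to passing to the span (`isBlockConj_span_iff`).
* `exists_mem_apply_eq_of_surjective` — GOURSAT WITH CLASSES: `L ⊆ ⊕_k 𝔰𝔩₂(F)` bracket-closed, slotwise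
  trace-free, surjecting on the factor `i` ⟹ for every trace-free `Z` some `z ∈ L` has `z i = Z` and `z k = 0`
  at every `k ≠ i` not conjugate to `i`. PROOF: restrict `L` to the slots `{i} ∪ {k : ¬ IsBlockConj L i k}`;
  there hypothesis (b) of brick R1a holds by definition, so the restriction contains `(0,…,Z,…,0)`.
* `exists_mem_span_apply_eq_of_places` — THE PLACES FORM WITHOUT (b): `S ⊆ ⊕_k 𝔰𝔩₂(F)` closed under the
  commutator up to `F`-span, `J` in the `K`-span of `S` with (i) no `J_k` having an `F`-rational eigenline and
  (a) two members of `S` with non-commuting `k`-blocks at every `k` ⟹ same conclusion for `span_F S`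
  (surjectivity at each slot is the tree's `single_sl2_mem_span_of_places` on the ONE-slot restriction, where
  (b) is vacuous).

## References

* [Hazama1983] F. Hazama, *Algebraic cycles on abelian varieties with many real endomorphisms*, Tôhoku
  Math. J. 35 (1983) 303–308 (held `paper:doi-10-2748-tmj-1178229056`): Prop. (2.6) p. 304 (Ribet's lemma),
  Lemma (3.1) and §3 p. 306. [cite: Hazama1983, Prop. (2.6), Lemma (3.1) and §3 (p. 306)]
* [MoonenZarhin1999LowDim] B. J. J. Moonen, Yu. G. Zarhin, Math. Ann. 315 (1999) 711–733, (2.2) Type 2(1)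
  («`Hg = U_{D^opp}`, `V_ℂ = W ⊗ ℂ²`»), §3 (3.1), Lemma (3.4). [cite: MoonenZarhin1999LowDim, (2.2) and §3 (3.1)]
* [Murty1988] V. Kumar Murty, *The Hodge group of an abelian variety*, Proc. AMS 104 (1988), Thm. 2.
  [cite: Murty1988, Thm. 2 (p. 67)]
* [Humphreys1972] J. E. Humphreys, GTM 9, §2.1 (`𝔰𝔩₂` is simple). [cite: Humphreys1972, §2.1 Example]
-/

noncomputable section

namespace Literature.RepresentationTheory.GeneralLinear

open Matrix

/-! ### §1 Conjugate slots -/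

section Conj

variable {F : Type*} [Field F] {ι : Type*}

/-- **Conjugate slots of a family of `2 × 2`-block families.** The slot `i` is CONJUGATE to the slot `k`
for `S ⊆ ⊕_k 𝔤𝔩₂(F)` if one invertible matrix `g` conjugates the `k`-block of every member of `S` onto its
`i`-block: `z i = g (z k) g⁻¹` for all `z ∈ S` — the `i`-th and `k`-th projections of `S` are «the graph of
an automorphism» (Hazama 1983, Lemma (3.1): a subalgebra of `𝔰𝔩₂ × 𝔰𝔩₂` surjecting on both factors is
everything or such a graph). [cite: Hazama1983, Lemma (3.1) (p. 306)] -/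
def IsBlockConj (S : Set (ι → Matrix (Fin 2) (Fin 2) F)) (i k : ι) : Prop :=
  ∃ g g' : Matrix (Fin 2) (Fin 2) F, g * g' = 1 ∧ g' * g = 1 ∧ ∀ z ∈ S, z i = g * z k * g'

/-- Unfolding `IsBlockConj`. [cite: Hazama1983, Lemma (3.1) (p. 306)] -/
theorem isBlockConj_iff (S : Set (ι → Matrix (Fin 2) (Fin 2) F)) (i k : ι) :
    IsBlockConj S i k ↔
      ∃ g g' : Matrix (Fin 2) (Fin 2) F, g * g' = 1 ∧ g' * g = 1 ∧ ∀ z ∈ S, z i = g * z k * g' :=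
  Iff.rfl

/-- Every slot is conjugate to itself (`g = 1`). [cite: Hazama1983, Lemma (3.1) (p. 306)] -/
theorem isBlockConj_refl (S : Set (ι → Matrix (Fin 2) (Fin 2) F)) (i : ι) : IsBlockConj S i i :=
  ⟨1, 1, Matrix.mul_one _, Matrix.mul_one _, fun z _ => by rw [Matrix.one_mul, Matrix.mul_one]⟩

/-- Conjugacy of slots is symmetric (`z k = g⁻¹ (z i) g`). [cite: Hazama1983, Lemma (3.1) (p. 306)] -/
theorem IsBlockConj.symm {S : Set (ι → Matrix (Fin 2) (Fin 2) F)} {i k : ι} (h : IsBlockConj S i k) :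
    IsBlockConj S k i := by
  obtain ⟨g, g', hgg', hg'g, hz⟩ := h
  refine ⟨g', g, hg'g, hgg', fun z hzS => ?_⟩
  rw [hz z hzS, ← Matrix.mul_assoc, ← Matrix.mul_assoc, hg'g, Matrix.one_mul, Matrix.mul_assoc, hg'g,
    Matrix.mul_one]

/-- Conjugacy of slots is transitive (compose the conjugations). [cite: Hazama1983, Lemma (3.1) (p. 306)] -/
theorem IsBlockConj.trans {S : Set (ι → Matrix (Fin 2) (Fin 2) F)} {i k l : ι} (h₁ : IsBlockConj S i k)
    (h₂ : IsBlockConj S k l) : IsBlockConj S i l := by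
  obtain ⟨g, g', hgg', hg'g, hz⟩ := h₁
  obtain ⟨h, h', hhh', hh'h, hw⟩ := h₂
  refine ⟨g * h, h' * g', ?_, ?_, fun z hzS => ?_⟩
  · rw [Matrix.mul_assoc, ← Matrix.mul_assoc h, hhh', Matrix.one_mul, hgg']
  · rw [Matrix.mul_assoc, ← Matrix.mul_assoc g', hg'g, Matrix.one_mul, hh'h]
  · rw [hz z hzS, hw z hzS]
    simp only [Matrix.mul_assoc]

/-- Conjugacy for a larger family implies conjugacy for a smaller one (the same `g` works).
[cite: Hazama1983, Lemma (3.1) (p. 306)] -/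
theorem IsBlockConj.mono {S S' : Set (ι → Matrix (Fin 2) (Fin 2) F)} (hSS' : S ⊆ S') {i k : ι}
    (h : IsBlockConj S' i k) : IsBlockConj S i k := by
  obtain ⟨g, g', hgg', hg'g, hz⟩ := h
  exact ⟨g, g', hgg', hg'g, fun z hzS => hz z (hSS' hzS)⟩

/-- **Conjugacy is insensitive to the span**: the members of `span_F S` are conjugated by the same `g`
as the members of `S` (the relation `z i = g (z k) g'` is `F`-linear in `z`). [cite: Hazama1983, Lemma (3.1) (p. 306)] -/
theorem isBlockConj_span_iff (S : Set (ι → Matrix (Fin 2) (Fin 2) F)) (i k : ι) :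
    IsBlockConj (Submodule.span F S : Set (ι → Matrix (Fin 2) (Fin 2) F)) i k ↔ IsBlockConj S i k := by
  refine ⟨fun h => h.mono Submodule.subset_span, fun h => ?_⟩
  obtain ⟨g, g', hgg', hg'g, hz⟩ := h
  refine ⟨g, g', hgg', hg'g, fun z hz' => ?_⟩
  induction hz' using Submodule.span_induction with
  | mem z hzS => exact hz z hzS
  | zero => rw [Pi.zero_apply, Pi.zero_apply, Matrix.mul_zero, Matrix.zero_mul]
  | add x y _ _ hx hy => rw [Pi.add_apply, Pi.add_apply, hx, hy, Matrix.mul_add, Matrix.add_mul]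
  | smul c x _ hx => rw [Pi.smul_apply, Pi.smul_apply, hx, Matrix.mul_smul, Matrix.smul_mul]

/-- **Blocks at conjugate slots are determined**: if `i` is conjugate to `k` through `(g, g')` then an
element with `k`-block `0` has `i`-block `0`. [cite: Hazama1983, Lemma (3.1) (p. 306)] -/
theorem IsBlockConj.apply_eq_zero {S : Set (ι → Matrix (Fin 2) (Fin 2) F)} {i k : ι} (h : IsBlockConj S i k)
    {z : ι → Matrix (Fin 2) (Fin 2) F} (hz : z ∈ S) (hk : z k = 0) : z i = 0 := by
  obtain ⟨g, g', -, -, hzz⟩ := h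
  rw [hzz z hz, hk, Matrix.mul_zero, Matrix.zero_mul]

end Conj

/-! ### §2 Goursat with classes: reaching a factor modulo the slots conjugate to it -/

section Goursat

variable {F : Type*} [Field F] [CharZero F] {ι : Type*} [Fintype ι] [DecidableEq ι]

/-- **Goursat's lemma with classes** (Hazama 1983 Prop. (2.6) + Lemma (3.1), merged as in brick R1a but with
NO non-conjugacy hypothesis). Let `L ⊆ ⊕_k 𝔰𝔩₂(F)` be an `F`-subspace closed under the commutator whose
`i`-th projection is all of `𝔰𝔩₂(F)`. Then for every trace-free `Z` there is `z ∈ L` with `z i = Z` and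
`z k = 0` at every slot `k ≠ i` that is NOT conjugate to `i` (at the conjugate slots `z k` is the conjugate of
`Z`). PROOF: the restriction of `L` to the slots `J = {i} ∪ {k : ¬ IsBlockConj L i k}` is bracket-closed,
trace-free, surjective at `i`, and in graph position over no pair `(k, i)`, `k ∈ J ∖ {i}` — by the very
definition of `J` — so brick R1a puts `(0, …, Z, …, 0)` in it. [cite: Hazama1983, Prop. (2.6) (p. 304), Lemma (3.1) and §3 (p. 306)]
[cite: MoonenZarhin1999LowDim, §3 (3.1), Lemma (3.4)] -/
theorem exists_mem_apply_eq_of_surjective (L : Submodule F (ι → Matrix (Fin 2) (Fin 2) F))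
    (hlie : ∀ A ∈ L, ∀ B ∈ L, A * B - B * A ∈ L) (htr : ∀ A ∈ L, ∀ k, (A k).trace = 0) {i : ι}
    (hsurj : ∀ W : Matrix (Fin 2) (Fin 2) F, W.trace = 0 → ∃ y ∈ L, y i = W)
    (Z : Matrix (Fin 2) (Fin 2) F) (hZ : Z.trace = 0) :
    ∃ z ∈ L, z i = Z ∧ ∀ k, k ≠ i → ¬ IsBlockConj (L : Set (ι → Matrix (Fin 2) (Fin 2) F)) i k → z k = 0 := by
  classical
  -- the slots kept: `i` and the slots not conjugate to `i`
  set P : ι → Prop := fun k => k = i ∨ ¬ IsBlockConj (L : Set (ι → Matrix (Fin 2) (Fin 2) F)) i k with hP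
  let J := {k : ι // P k}
  -- restriction to the kept slots
  set π : (ι → Matrix (Fin 2) (Fin 2) F) →ₗ[F] (J → Matrix (Fin 2) (Fin 2) F) :=
    LinearMap.funLeft F (Matrix (Fin 2) (Fin 2) F) (Subtype.val : J → ι) with hπ
  have π_apply : ∀ (A : ι → Matrix (Fin 2) (Fin 2) F) (j : J), π A j = A j.1 := fun A j => rfl
  have π_mul : ∀ A B : ι → Matrix (Fin 2) (Fin 2) F, π (A * B) = π A * π B := fun A B => by
    funext j; rfl
  set L' : Submodule F (J → Matrix (Fin 2) (Fin 2) F) := L.map π with hL'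
  have memL' : ∀ {A'}, A' ∈ L' ↔ ∃ A ∈ L, π A = A' := fun {A'} => Submodule.mem_map
  have hlie' : ∀ A' ∈ L', ∀ B' ∈ L', A' * B' - B' * A' ∈ L' := by
    intro A' hA' B' hB'
    obtain ⟨A, hA, rfl⟩ := memL'.1 hA'
    obtain ⟨B, hB, rfl⟩ := memL'.1 hB'
    exact memL'.2 ⟨A * B - B * A, hlie A hA B hB, by rw [map_sub, π_mul, π_mul]⟩
  have htr' : ∀ A' ∈ L', ∀ j, (A' j).trace = 0 := by
    intro A' hA' j
    obtain ⟨A, hA, rfl⟩ := memL'.1 hA'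
    rw [π_apply]; exact htr A hA j.1
  let i' : J := ⟨i, Or.inl rfl⟩
  have hsurj' : ∀ W : Matrix (Fin 2) (Fin 2) F, W.trace = 0 → ∃ y ∈ L', y i' = W := by
    intro W hW
    obtain ⟨y, hy, hyW⟩ := hsurj W hW
    exact ⟨π y, memL'.2 ⟨y, hy, rfl⟩, by rw [π_apply]; exact hyW⟩
  have hng' : ∀ k' : J, k' ≠ i' → ∀ g g' : Matrix (Fin 2) (Fin 2) F, g * g' = 1 → g' * g = 1 →
      ∃ z ∈ L', z i' ≠ g * z k' * g' := by
    intro k' hk' g g' hgg' hg'g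
    have hki : (k' : ι) ≠ i := fun h => hk' (Subtype.ext h)
    have hnc : ¬ IsBlockConj (L : Set (ι → Matrix (Fin 2) (Fin 2) F)) i k' := by
      rcases k'.2 with h | h
      · exact absurd h hki
      · exact h
    have hex : ∃ z ∈ (L : Set (ι → Matrix (Fin 2) (Fin 2) F)), z i ≠ g * z k' * g' := by
      by_contra hcon
      push Not at hcon
      exact hnc ⟨g, g', hgg', hg'g, hcon⟩
    obtain ⟨z, hz, hne⟩ := hex
    exact ⟨π z, memL'.2 ⟨z, hz, rfl⟩, by rw [π_apply, π_apply]; exact hne⟩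
  -- brick R1a on the restriction
  have hmem : Pi.single i' Z ∈ L' :=
    single_sl2_mem_of_surjective_of_forall_exists_ne_conj L' hlie' htr' hsurj' hng' Z hZ
  obtain ⟨z, hz, hπz⟩ := memL'.1 hmem
  refine ⟨z, hz, ?_, fun k hki hnc => ?_⟩
  · have h := congrFun hπz i'
    rw [π_apply, Pi.single_eq_same] at h
    exact h
  · let j : J := ⟨k, Or.inr hnc⟩
    have hj : j ≠ i' := fun h => hki (congrArg Subtype.val h)
    have h := congrFun hπz j
    rw [π_apply, Pi.single_eq_of_ne hj] at h
    exact h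

omit [CharZero F] [Fintype ι] [DecidableEq ι] in
/-- **The blocks at the conjugate slots**: for the element of `exists_mem_apply_eq_of_surjective` (indeed for
any `z ∈ L`), `z k = g' Z g` whenever `i` is conjugate to `k` through `(g, g')` and `z i = Z`.
[cite: Hazama1983, Lemma (3.1) (p. 306)] -/
theorem apply_eq_conj_of_isBlockConj {S : Set (ι → Matrix (Fin 2) (Fin 2) F)} {i k : ι}
    {g g' : Matrix (Fin 2) (Fin 2) F} (hg'g : g' * g = 1)
    (hS : ∀ z ∈ S, z i = g * z k * g') {z : ι → Matrix (Fin 2) (Fin 2) F} (hz : z ∈ S)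
    {Z : Matrix (Fin 2) (Fin 2) F} (hzi : z i = Z) : z k = g' * Z * g := by
  rw [← hzi, hS z hz, ← Matrix.mul_assoc, ← Matrix.mul_assoc, hg'g, Matrix.one_mul, Matrix.mul_assoc,
    hg'g, Matrix.mul_one]

end Goursat

/-! ### §3 The places form without the non-conjugacy hypothesis -/

section Places

variable {F K : Type*} [Field F] [Field K] [CharZero K] [Algebra F K]
variable {ι : Type*} [Fintype ι] [DecidableEq ι]

omit [Fintype ι] [DecidableEq ι] in
/-- The `F`-span of a family closed under the commutator up to span is closed under the commutator. [folklore] -/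
private theorem span_commutator_mem (S : Set (ι → Matrix (Fin 2) (Fin 2) F))
    (hlie : ∀ A ∈ S, ∀ B ∈ S, A * B - B * A ∈ Submodule.span F S) :
    ∀ A ∈ Submodule.span F S, ∀ B ∈ Submodule.span F S, A * B - B * A ∈ Submodule.span F S := by
  set L := Submodule.span F S with hL
  have h1 : ∀ B ∈ S, ∀ A ∈ L, A * B - B * A ∈ L := by
    intro B hB A hA
    refine Submodule.span_induction (p := fun A _ => A * B - B * A ∈ L) ?_ ?_ ?_ ?_ hA
    · intro A hA'
      exact hlie A hA' B hB
    · rw [zero_mul, mul_zero, sub_zero]; exact L.zero_mem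
    · intro x y _ _ hx hy
      have : (x + y) * B - B * (x + y) = (x * B - B * x) + (y * B - B * y) := by noncomm_ring
      rw [this]; exact L.add_mem hx hy
    · intro c x _ hx
      have : (c • x) * B - B * (c • x) = c • (x * B - B * x) := by
        rw [smul_mul_assoc, mul_smul_comm, smul_sub]
      rw [this]; exact L.smul_mem c hx
  intro A hA B hB
  refine Submodule.span_induction (p := fun B _ => A * B - B * A ∈ L) ?_ ?_ ?_ ?_ hB
  · intro B hB'
    exact h1 B hB' A hA
  · rw [zero_mul, mul_zero, sub_zero]; exact L.zero_mem
  · intro x y _ _ hx hy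
    have : A * (x + y) - (x + y) * A = (A * x - x * A) + (A * y - y * A) := by noncomm_ring
    rw [this]; exact L.add_mem hx hy
  · intro c x _ hx
    have : A * (c • x) - (c • x) * A = c • (A * x - x * A) := by
      rw [mul_smul_comm, smul_mul_assoc, smul_sub]
    rw [this]; exact L.smul_mem c hx

omit [Fintype ι] [DecidableEq ι] in
/-- The `F`-span of a slotwise trace-free family is slotwise trace-free. [folklore] -/
private theorem span_trace_eq_zero (S : Set (ι → Matrix (Fin 2) (Fin 2) F)) (htr : ∀ A ∈ S, ∀ k, (A k).trace = 0) :
    ∀ A ∈ Submodule.span F S, ∀ k, (A k).trace = 0 := by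
  intro A hA k
  refine Submodule.span_induction (p := fun A _ => (A k).trace = 0) ?_ ?_ ?_ ?_ hA
  · intro A hA'; exact htr A hA' k
  · simp
  · intro x y _ _ hx hy
    rw [Pi.add_apply, Matrix.trace_add, hx, hy, add_zero]
  · intro c x _ hx
    rw [Pi.smul_apply, Matrix.trace_smul, hx, smul_zero]

omit [Fintype ι] [DecidableEq ι] in
/-- **Surjectivity at a slot from (i) and (a)** (no hypothesis (b)): under the hypotheses of the places form
at the slot `i` alone — `S` closed under the commutator up to `F`-span, slotwise trace-free, `J` in the
`K`-span of `S` with `J_i` having no `F`-rational eigenline, two members of `S` with non-commuting `i`-blocks —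
every trace-free `W` is the `i`-block of a member of `span_F S`. (The tree's `single_sl2_mem_span_of_places`
applied to the ONE-slot restriction of `S`, where the non-conjugacy hypothesis is vacuous; Hazama 1983 §3:
«`p_i(𝔥) = 𝔰𝔩₂`».) [cite: Hazama1983, §3 (pp. 305–306)] [cite: MoonenZarhin1999LowDim, §1 and §3 (3.1)] -/
theorem exists_mem_span_apply_eq_of_noRationalEigenline (S : Set (ι → Matrix (Fin 2) (Fin 2) F))
    (hlie : ∀ A ∈ S, ∀ B ∈ S, A * B - B * A ∈ Submodule.span F S)
    (htr : ∀ A ∈ S, ∀ k, (A k).trace = 0)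
    {J : ι → Matrix (Fin 2) (Fin 2) K}
    (hJ : J ∈ Submodule.span K
      ((fun A : ι → Matrix (Fin 2) (Fin 2) F => fun k => (A k).map (algebraMap F K)) '' S))
    (i : ι)
    (hi : ∀ (v : Fin 2 → F), v ≠ 0 → ∀ μ : K,
      (J i).mulVec (fun a => algebraMap F K (v a)) ≠ μ • fun a => algebraMap F K (v a))
    (hna : ∃ A ∈ S, ∃ B ∈ S, A i * B i - B i * A i ≠ 0)
    (W : Matrix (Fin 2) (Fin 2) F) (hW : W.trace = 0) :
    ∃ y ∈ Submodule.span F S, y i = W := by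
  classical
  -- restriction to the single slot `i`
  set ρ : (ι → Matrix (Fin 2) (Fin 2) F) →ₗ[F] (Unit → Matrix (Fin 2) (Fin 2) F) :=
    LinearMap.funLeft F (Matrix (Fin 2) (Fin 2) F) (fun _ : Unit => i) with hρ
  have ρ_apply : ∀ (A : ι → Matrix (Fin 2) (Fin 2) F) (u : Unit), ρ A u = A i := fun A u => rfl
  have ρ_mul : ∀ A B : ι → Matrix (Fin 2) (Fin 2) F, ρ (A * B) = ρ A * ρ B := fun A B => by
    funext u; rfl
  set S₁ : Set (Unit → Matrix (Fin 2) (Fin 2) F) := ρ '' S with hS₁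
  have hspan₁ : Submodule.span F S₁ = (Submodule.span F S).map ρ := by
    rw [hS₁, Submodule.map_span]
  have hlie₁ : ∀ A ∈ S₁, ∀ B ∈ S₁, A * B - B * A ∈ Submodule.span F S₁ := by
    rintro _ ⟨A, hA, rfl⟩ _ ⟨B, hB, rfl⟩
    rw [hspan₁, ← ρ_mul, ← ρ_mul, ← map_sub]
    exact Submodule.mem_map_of_mem (hlie A hA B hB)
  have htr₁ : ∀ A ∈ S₁, ∀ u, (A u).trace = 0 := by
    rintro _ ⟨A, hA, rfl⟩ u
    rw [ρ_apply]; exact htr A hA i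
  -- `J` restricted
  set ρK : (ι → Matrix (Fin 2) (Fin 2) K) →ₗ[K] (Unit → Matrix (Fin 2) (Fin 2) K) :=
    LinearMap.funLeft K (Matrix (Fin 2) (Fin 2) K) (fun _ : Unit => i) with hρK
  have hJ₁ : ρK J ∈ Submodule.span K
      ((fun A : Unit → Matrix (Fin 2) (Fin 2) F => fun u => (A u).map (algebraMap F K)) '' S₁) := by
    have h1 : ρK J ∈ (Submodule.span K ((fun A : ι → Matrix (Fin 2) (Fin 2) F =>
        fun k => (A k).map (algebraMap F K)) '' S)).map ρK := Submodule.mem_map_of_mem hJ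
    rw [Submodule.map_span] at h1
    refine Submodule.span_mono ?_ h1
    rintro _ ⟨_, ⟨A, hA, rfl⟩, rfl⟩
    exact ⟨ρ A, ⟨A, hA, rfl⟩, rfl⟩
  have hi₁ : ∀ (u : Unit) (v : Fin 2 → F), v ≠ 0 → ∀ μ : K,
      (ρK J u).mulVec (fun a => algebraMap F K (v a)) ≠ μ • fun a => algebraMap F K (v a) :=
    fun u v hv μ => hi v hv μ
  have hna₁ : ∀ u : Unit, ∃ A ∈ S₁, ∃ B ∈ S₁, A u * B u - B u * A u ≠ 0 := by
    intro u
    obtain ⟨A, hA, B, hB, hAB⟩ := hna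
    exact ⟨ρ A, ⟨A, hA, rfl⟩, ρ B, ⟨B, hB, rfl⟩, hAB⟩
  have hng₁ : ∀ i₁ k₁ : Unit, k₁ ≠ i₁ → ∀ g g' : Matrix (Fin 2) (Fin 2) F, g * g' = 1 → g' * g = 1 →
      ∃ z ∈ S₁, z i₁ ≠ g * z k₁ * g' := fun i₁ k₁ hk => absurd (Subsingleton.elim k₁ i₁) hk
  have hmem : Pi.single () W ∈ Submodule.span F S₁ :=
    single_sl2_mem_span_of_places S₁ hlie₁ htr₁ hJ₁ hi₁ hna₁ hng₁ () W hW
  rw [hspan₁] at hmem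
  obtain ⟨y, hy, hρy⟩ := Submodule.mem_map.1 hmem
  refine ⟨y, hy, ?_⟩
  have h := congrFun hρy ()
  rw [ρ_apply, Pi.single_eq_same] at h
  exact h

/-- **The places form of Goursat with classes** (Hazama 1983 §3 without the hypothesis «the `V_i` are
mutually non-isomorphic»; Moonen–Zarhin 1999 (2.2) Type 2(1): `Hg = U_{D^opp}` acting on `V_ℂ = W ⊗ ℂ²`
through ONE `𝔰𝔩₂` on two blocks). Let `F → K` be fields of characteristic zero, `ι` finite, `S ⊆ ⊕_k 𝔰𝔩₂(F)`
slotwise trace-free and closed under the commutator up to `F`-span, `J ∈ ⊕_k 𝔤𝔩₂(K)` in the `K`-span of `S`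
with (i) no `J_k` having an `F`-rational eigenline and (a) at every slot two members of `S` with non-commuting
blocks. Then for every slot `i` and trace-free `Z` there is `z ∈ span_F S` with `z i = Z` and `z k = 0` at every
`k ≠ i` not conjugate to `i` for `S` (`IsBlockConj S i k`); at the conjugate slots the blocks of `z` are the
conjugates of `Z` (`apply_eq_conj_of_isBlockConj` with `isBlockConj_span_iff`). With (b) «no two slots
conjugate» this is the tree's `single_sl2_mem_span_of_places`. [cite: Hazama1983, §3 (pp. 305–306), Prop. (2.6) and Lemma (3.1)]
[cite: MoonenZarhin1999LowDim, (2.2) and §3 (3.1)] -/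
theorem exists_mem_span_apply_eq_of_places (S : Set (ι → Matrix (Fin 2) (Fin 2) F))
    (hlie : ∀ A ∈ S, ∀ B ∈ S, A * B - B * A ∈ Submodule.span F S)
    (htr : ∀ A ∈ S, ∀ k, (A k).trace = 0)
    {J : ι → Matrix (Fin 2) (Fin 2) K}
    (hJ : J ∈ Submodule.span K
      ((fun A : ι → Matrix (Fin 2) (Fin 2) F => fun k => (A k).map (algebraMap F K)) '' S))
    (hi : ∀ (k : ι) (v : Fin 2 → F), v ≠ 0 → ∀ μ : K,
      (J k).mulVec (fun a => algebraMap F K (v a)) ≠ μ • fun a => algebraMap F K (v a))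
    (hna : ∀ k : ι, ∃ A ∈ S, ∃ B ∈ S, A k * B k - B k * A k ≠ 0)
    (i : ι) (Z : Matrix (Fin 2) (Fin 2) F) (hZ : Z.trace = 0) :
    ∃ z ∈ Submodule.span F S, z i = Z ∧ ∀ k, k ≠ i → ¬ IsBlockConj S i k → z k = 0 := by
  haveI : CharZero F := (algebraMap F K).charZero
  obtain ⟨z, hz, hzi, hzk⟩ := exists_mem_apply_eq_of_surjective (Submodule.span F S)
    (span_commutator_mem S hlie) (span_trace_eq_zero S htr)
    (fun W hW => exists_mem_span_apply_eq_of_noRationalEigenline S hlie htr hJ i (hi i) (hna i) W hW) Z hZ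
  exact ⟨z, hz, hzi, fun k hki hnc => hzk k hki fun h => hnc ((isBlockConj_span_iff S i k).1 h)⟩

end Places

end Literature.RepresentationTheory.GeneralLinear

end
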